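import Summits.Ventures.YMGap.RobustBall.ConcentrationSummable
import Summits.Ventures.YMGap.RobustBall.ConcentrationLatticeSums
import Summits.Ventures.YMGap.RobustBall.UniformPlaquetteSusceptibility
import HarnessLib

/-!
# Venture YMGap, track ROBUST-BALL — GAUSSIAN CONCENTRATION, TIER 2 (continued): explicit lattice proxies for the exponential
# influence profile, and the `SU(2)` / every-`N` readings on the tier-2 ball `MemBallZdS`

HONEST FRAMING. WHAT THIS IS: a venture file (cell `pub-ymgap`, track Y2 ROBUST-BALL, seat ds-3, theorems only) continuing
`ConcentrationSummable.lean`. There the variance proxy `V ≥ Σ_y (Σ_i 2√N K_i Σ_{z ∈ Δ_i} e^{−t‖z − y‖_∞})²` is a hypothesis; here it is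
made EXPLICIT (lossy `ℓ¹` comparison, as in the tier-1 file `ConcentrationLatticeSums.lean`):
* `exp_neg_sq_le_pow_l1` / `sum_boxLinks_exp_sq_le` — `(e^{−t‖v‖_∞})² ≤ r₂^{ℓ¹(v)}`, `r₂ = e^{−2t/d}`, and for every link `z` and every box
  `Σ_{y ∈ boxLinks d n} (e^{−t‖z − y‖_∞})² ≤ d · ((1 + r₂)/(1 − r₂))^d =: d Θ₂(t)` (`t > 0`);
* ★ `sum_boxLinks_influenceS_sq_le` — ONE LIPSCHITZ CYLINDER: `Σ_{y ∈ boxLinks d n} (2√N K Σ_{z ∈ Δ} e^{−t‖z − y‖_∞})² ≤ 4 N K² d #Δ² Θ₂(t)`;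
* ★★ `dlrS_abs_sub_integral_ge_le_explicit` — TIER 2, `SU(N)`, under rb-p1's weighted row condition with `t > 0`: for EVERY DLR state `μ`
  of the member and every Lipschitz cylinder `F` (constant `K`, links `Δ`):
  `μ{|F − ∫F dμ| ≥ r} ≤ 2 exp(−2 r² / (4 N K² d #Δ² Θ₂(t)))`;
* ★ `suN_dlrS_abs_sub_integral_ge_le_bakryEmery` (every `N ≥ 2`, hypothesis-free Bakry–Émery pair, on `MemBallZdS a Λ_t t W`) and
  ★★ `su2_dlrS_abs_sub_integral_ge_le` (`SU(2)`, sharp pair: `2(d−1)|β_W| e^{a} e^{t} + e^{a/2} √(2/3) Λ_t < 1`, on `MemBallZdS`):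
  `μ{|F − ∫F dμ| ≥ r} ≤ 2 exp(−2 r² / (8 K² d #Δ² Θ₂(t)))`.
WHAT THIS IS NOT: strong-coupling LATTICE statements inside the tier-2 ball with existence-grade (lossy) constants; not an LDP, not a
CLT; nothing about the continuum limit or the Clay Millennium problem.

References: C. McDiarmid (1989); C. Külske, CMP 239 (2003) 29–51; H. Föllmer, LNM 1362 (1988), Ch. I, (2.8), (2.10), Cor. (2.14); the
seat's `ConcentrationSummable.lean`, `ConcentrationLatticeSums.lean`, rb-p1's `LatticeSumL1.lean`, `UniformPlaquetteSusceptibility.lean`.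
-/

noncomputable section

open MeasureTheory Filter Function ProbabilityTheory Real Topology
open scoped NNReal
open Literature.Probability.LatticeModels
open Literature.Probability.LatticeModels.DobrushinMetric
open Literature.MathematicalPhysics.QuantumLattice
open Literature.MathematicalPhysics.QuantumFieldTheory hiding ZdEdge
open Summit.QuantumFields.BalabanUV.InfraRed.StrongCouplingPoincareDoorSUN (oneLinkPoincareSUN_two_sharp oneLinkPoincareSUN_bakryEmery)
open Summit.QuantumFields.BalabanUV.InfraRed.StrongCouplingVarianceDoorSUN (oneLinkVarianceBound_bakryEmery)

namespace Summit.Ventures.YMGap.RobustBall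

/-! ### Elementary lattice sums for the exponential profile -/

section Lattice

variable {d : ℕ}

/-- `(e^{−t‖v‖_∞})² ≤ r₂^{ℓ¹(v)}` with `r₂ = e^{−2t/d}` (`t ≥ 0`, `d ≥ 1`; `‖v‖₁ ≤ d ‖v‖_∞`). [folklore] -/
theorem exp_neg_sq_le_pow_l1 (hd : 1 ≤ d) {t : ℝ} (ht : 0 ≤ t) (v : Site d) :
    exp (-(t * ‖v‖)) ^ 2 ≤ exp (-(2 * t / d)) ^ l1 v := by
  have h := exp_neg_norm_le_pow hd (m := 2 * t) (by linarith) v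
  have e : exp (-(t * ‖v‖)) ^ 2 = exp (-(2 * t) * ‖v‖) := by rw [← Real.exp_nat_mul]; ring_nf
  rw [e]
  exact h

/-- The ratio `r₂ = e^{−2t/d}` lies in `[0, 1)` for `t > 0`, `d ≥ 1`. [folklore] -/
theorem exp_neg_two_mul_div_lt_one (hd : 1 ≤ d) {t : ℝ} (ht : 0 < t) :
    0 ≤ exp (-(2 * t / d)) ∧ exp (-(2 * t / d)) < 1 := by
  refine ⟨(exp_pos _).le, exp_lt_one_iff.2 ?_⟩
  have hdpos : (0 : ℝ) < d := by exact_mod_cast hd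
  have : 0 < 2 * t / d := div_pos (by linarith) hdpos
  linarith

/-- **Box sum of the squared exponential profile around a link**: for `t > 0` and every link `z`, every box,
`Σ_{y ∈ boxLinks d n} (e^{−t‖z − y‖_∞})² ≤ d · ((1 + r₂)/(1 − r₂))^d`, `r₂ = e^{−2t/d}`. [folklore] -/
theorem sum_boxLinks_exp_sq_le (hd : 1 ≤ d) {t : ℝ} (ht : 0 < t) (z : ZdEdge d) (n : ℕ) :
    ∑ y ∈ boxLinks d n, exp (-(t * ‖z.1 - y.1‖)) ^ 2 ≤
      d * ((1 + exp (-(2 * t / d))) / (1 - exp (-(2 * t / d)))) ^ d := by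
  set r : ℝ := exp (-(2 * t / d)) with hr
  obtain ⟨hr0, hr1⟩ := exp_neg_two_mul_div_lt_one hd ht
  rw [boxLinks, Finset.sum_product]
  calc ∑ x ∈ siteBox d n, ∑ i : Fin d, exp (-(t * ‖z.1 - (x, i).1‖)) ^ 2
      = ∑ x ∈ siteBox d n, (d : ℝ) * exp (-(t * ‖z.1 - x‖)) ^ 2 := by
        refine Finset.sum_congr rfl fun x _ => ?_
        simp only [Finset.sum_const, Finset.card_univ, Fintype.card_fin, nsmul_eq_mul]
    _ ≤ ∑ x ∈ siteBox d n, (d : ℝ) * r ^ l1 (z.1 - x) :=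
        Finset.sum_le_sum fun x _ => mul_le_mul_of_nonneg_left (exp_neg_sq_le_pow_l1 hd ht.le (z.1 - x)) (Nat.cast_nonneg _)
    _ = d * ∑ x ∈ siteBox d n, r ^ l1 (z.1 - x) := by rw [Finset.mul_sum]
    _ ≤ d * ((1 + r) / (1 - r)) ^ d := mul_le_mul_of_nonneg_left (sum_pow_l1_sub_le hr0 hr1 z.1 (siteBox d n)) (by positivity)

/-- ★ **EXPLICIT VARIANCE PROXY FOR ONE LIPSCHITZ CYLINDER, exponential profile**: for `t > 0`, `d ≥ 1` and every box,
`Σ_{y ∈ boxLinks d n} (2√N K Σ_{z ∈ Δ} e^{−t‖z − y‖_∞})² ≤ 4 N K² d #Δ² Θ₂(t)`, `Θ₂(t) = ((1 + r₂)/(1 − r₂))^d`, `r₂ = e^{−2t/d}` (Cauchy–Schwarz in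
`z`, then the box sum). [folklore] -/
theorem sum_boxLinks_influenceS_sq_le {N : ℕ} (hd : 1 ≤ d) {t : ℝ} (ht : 0 < t) (K : ℝ≥0) (Δ : Finset (ZdEdge d)) (n : ℕ) :
    ∑ y ∈ boxLinks d n, (2 * Real.sqrt N * K * ∑ z ∈ Δ, exp (-(t * ‖z.1 - y.1‖))) ^ 2 ≤
      4 * N * (K : ℝ) ^ 2 * d * (Δ.card : ℝ) ^ 2 * ((1 + exp (-(2 * t / d))) / (1 - exp (-(2 * t / d)))) ^ d := by
  set Θ : ℝ := ((1 + exp (-(2 * t / d))) / (1 - exp (-(2 * t / d)))) ^ d with hΘ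
  have hsqrt : Real.sqrt N ^ 2 = N := Real.sq_sqrt (Nat.cast_nonneg N)
  have hCS : ∀ y : ZdEdge d, (∑ z ∈ Δ, exp (-(t * ‖z.1 - y.1‖))) ^ 2 ≤
      Δ.card * ∑ z ∈ Δ, exp (-(t * ‖z.1 - y.1‖)) ^ 2 := fun y => sq_sum_le_card_mul_sum_sq
  calc ∑ y ∈ boxLinks d n, (2 * Real.sqrt N * K * ∑ z ∈ Δ, exp (-(t * ‖z.1 - y.1‖))) ^ 2
      = (2 * Real.sqrt N * K) ^ 2 * ∑ y ∈ boxLinks d n, (∑ z ∈ Δ, exp (-(t * ‖z.1 - y.1‖))) ^ 2 := by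
        rw [Finset.mul_sum]
        exact Finset.sum_congr rfl fun y _ => by ring
    _ ≤ (2 * Real.sqrt N * K) ^ 2 * ∑ y ∈ boxLinks d n, ((Δ.card : ℝ) * ∑ z ∈ Δ, exp (-(t * ‖z.1 - y.1‖)) ^ 2) :=
        mul_le_mul_of_nonneg_left (Finset.sum_le_sum fun y _ => hCS y) (sq_nonneg _)
    _ = (2 * Real.sqrt N * K) ^ 2 * ((Δ.card : ℝ) * ∑ z ∈ Δ, ∑ y ∈ boxLinks d n, exp (-(t * ‖z.1 - y.1‖)) ^ 2) := by
        rw [← Finset.mul_sum, Finset.sum_comm]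
    _ ≤ (2 * Real.sqrt N * K) ^ 2 * ((Δ.card : ℝ) * ∑ _z ∈ Δ, (d : ℝ) * Θ) := by
        refine mul_le_mul_of_nonneg_left (mul_le_mul_of_nonneg_left
          (Finset.sum_le_sum fun z _ => sum_boxLinks_exp_sq_le hd ht z n) (Nat.cast_nonneg _)) (sq_nonneg _)
    _ = 4 * N * (K : ℝ) ^ 2 * d * (Δ.card : ℝ) ^ 2 * Θ := by
        rw [Finset.sum_const, nsmul_eq_mul, mul_pow, mul_pow, hsqrt]
        ring

end Lattice

/-! ### Tier 2, `SU(N)`: infinite-volume Gaussian concentration with an explicit proxy -/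

section SUN

variable {d N : ℕ}
variable {W : Potential (ZdEdge d) (Matrix.specialUnitaryGroup (Fin N) ℂ)} {B : Finset (ZdEdge d) → ℝ}

/-- ★★ **TIER 2, `SU(N)`, EXPLICIT PROXY**: under rb-p1's weighted row condition (the hypotheses of `perturbedMassGapS_SU`) with `t > 0`, for
EVERY DLR state `μ` of the summable member and every Lipschitz cylinder `F` (constant `K`, links `Δ`), every `r ≥ 0`:
`μ{|F − ∫F dμ| ≥ r} ≤ 2 exp(−2 r² / (4 N K² d #Δ² Θ₂(t)))`, `Θ₂(t) = ((1 + e^{−2t/d})/(1 − e^{−2t/d}))^d`. [folklore] -/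
theorem dlrS_abs_sub_integral_ge_le_explicit (hd : 1 ≤ d) (hN : 1 ≤ N) {β b c v a Λt t : ℝ}
    (hc : 0 ≤ c) (hv : 0 ≤ v) (hb : |β| * (2 * ((d : ℝ) - 1)) ≤ b)
    (hP : ∀ B : Matrix (Fin N) (Fin N) ℂ, matrixOpNorm B ≤ b →
      ∀ (ψ : Matrix.specialUnitaryGroup (Fin N) ℂ → ℝ) (M : ℝ), 0 ≤ M →
        (∀ x y, |ψ x - ψ y| ≤ M * suFrobDist x y) →
        Var[ψ; (haarProbability (Matrix.specialUnitaryGroup (Fin N) ℂ)).tilted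
          fun g => (N : ℝ) * ((g : Matrix (Fin N) (Fin N) ℂ) * B).trace.re] ≤ c * M ^ 2)
    (hVB : ∀ B : Matrix (Fin N) (Fin N) ℂ, matrixOpNorm B ≤ b → ∀ Δ : Matrix (Fin N) (Fin N) ℂ,
      Var[fun g : Matrix.specialUnitaryGroup (Fin N) ℂ =>
          (N : ℝ) * ((g : Matrix (Fin N) (Fin N) ℂ) * Δ).trace.re;
        (haarProbability (Matrix.specialUnitaryGroup (Fin N) ℂ)).tilted
          fun g => (N : ℝ) * ((g : Matrix (Fin N) (Fin N) ℂ) * B).trace.re] ≤ v * frobNorm Δ ^ 2)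
    (h : IsLinkSummable W B) (hWc : ∀ X, Continuous (W X))
    (hWdep : ∀ X, DependsOn (W X) (↑X : Set (ZdEdge d)))
    {osc : Finset (ZdEdge d) → ZdEdge d → ℝ} (hosc : ∀ X, Dobrushin.IsOscBound (W X) (osc X))
    (hoscs : ∀ e, Summable fun X : Finset (ZdEdge d) => (if e ∈ X then osc X e else 0))
    (hosca : ∀ e, ∑' X : Finset (ZdEdge d), (if e ∈ X then osc X e else 0) ≤ a)
    {lip : Finset (ZdEdge d) → ZdEdge d → ℝ} (hlip : ∀ X, IsLipBound suFrobDist (W X) (lip X))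
    {ℓ : ZdEdge d → ZdEdge d → ℝ}
    (hlips : ∀ e y, Summable fun X : Finset (ZdEdge d) => (if e ∈ X ∧ y ∈ X then lip X y else 0))
    (hℓ : ∀ e y, y ≠ e → ∑' X : Finset (ZdEdge d), (if e ∈ X ∧ y ∈ X then lip X y else 0) ≤ ℓ e y)
    (ht : 0 < t) (hℓs : ∀ e, Summable fun y => (if y = e then 0 else ℓ e y) * exp (t * ‖e.1 - y.1‖))
    (hℓt : ∀ e, ∑' y, (if y = e then 0 else ℓ e y) * exp (t * ‖e.1 - y.1‖) ≤ Λt)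
    (hρ : 6 * ((d : ℝ) - 1) * |β| * (exp a * exp t * Real.sqrt (c * v)) + exp (a / 2) * Real.sqrt c * Λt < 1)
    {μ : Measure (LGConfig d (Matrix.specialUnitaryGroup (Fin N) ℂ))}
    (hμ : μ ∈ perturbedGibbsMeasuresS (d := d) (fundamentalRep (Fin N)) (N * β) W)
    {F : LGConfig d (Matrix.specialUnitaryGroup (Fin N) ℂ) → ℝ} {Δ : Finset (ZdEdge d)} {K : ℝ≥0}
    (hF : IsLipschitzCylinder (fundamentalRep (Fin N)) F Δ K) {r : ℝ} (hr : 0 ≤ r) :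
    μ.real {U | r ≤ |F U - ∫ U', F U' ∂μ|} ≤
      2 * exp (-2 * r ^ 2 / (4 * N * (K : ℝ) ^ 2 * d * (Δ.card : ℝ) ^ 2 *
        ((1 + exp (-(2 * t / d))) / (1 - exp (-(2 * t / d)))) ^ d)) := by
  have key := dlrS_sum_abs_sub_integral_ge_le hd hN hc hv hb hP hVB h hWc hWdep hosc hoscs hosca hlip hlips hℓ ht.le hℓs hℓt hρ
    ht (Finset.univ : Finset Unit) (F := fun _ => F) (Δ := fun _ => Δ) (K := fun _ => K) (fun _ _ => hF)
    (fun n => by simpa using sum_boxLinks_influenceS_sq_le (N := N) hd ht K Δ n) hμ hr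
  simpa using key

variable (W) in
/-- ★ **TIER 2, EVERY `N ≥ 2`, HYPOTHESIS-FREE (Bakry–Émery pair), ON THE BALL `MemBallZdS a Λ_t t W`** (`t > 0`): with
`b = 2(d−1)|β| < 1/2` and `6(d−1)|β| e^{a} e^{t}/(1/2 − b) + e^{a/2} Λ_t/√(N(1/2 − b)) < 1`, every DLR state of every member, every
Lipschitz cylinder: `μ{|F − ∫F dμ| ≥ r} ≤ 2 exp(−2 r² / (4 N K² d #Δ² Θ₂(t)))`. [folklore] -/
theorem suN_dlrS_abs_sub_integral_ge_le_bakryEmery (hd : 1 ≤ d) (hN : 2 ≤ N) {β a Λt t : ℝ}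
    (hb : |β| * (2 * ((d : ℝ) - 1)) < 1 / 2) (hmem : MemBallZdS a Λt t W) (ht : 0 < t)
    (hρ : 6 * ((d : ℝ) - 1) * |β| * (exp a * exp t) / (1 / 2 - |β| * (2 * ((d : ℝ) - 1))) +
      exp (a / 2) * Λt / Real.sqrt ((N : ℝ) * (1 / 2 - |β| * (2 * ((d : ℝ) - 1)))) < 1)
    {μ : Measure (LGConfig d (Matrix.specialUnitaryGroup (Fin N) ℂ))}
    (hμ : μ ∈ perturbedGibbsMeasuresS (d := d) (fundamentalRep (Fin N)) (N * β) W)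
    {F : LGConfig d (Matrix.specialUnitaryGroup (Fin N) ℂ) → ℝ} {Δ : Finset (ZdEdge d)} {K : ℝ≥0}
    (hF : IsLipschitzCylinder (fundamentalRep (Fin N)) F Δ K) {r : ℝ} (hr : 0 ≤ r) :
    μ.real {U | r ≤ |F U - ∫ U', F U' ∂μ|} ≤
      2 * exp (-2 * r ^ 2 / (4 * N * (K : ℝ) ^ 2 * d * (Δ.card : ℝ) ^ 2 *
        ((1 + exp (-(2 * t / d))) / (1 - exp (-(2 * t / d)))) ^ d)) := by
  obtain ⟨B₀, hB₀⟩ := hmem.summable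
  obtain ⟨osc, lip, ℓ, h1, h2, h3, h4, h5, h6, h7, h8⟩ := hmem.loads
  set b : ℝ := |β| * (2 * ((d : ℝ) - 1)) with hbdef
  have hNpos : (0 : ℝ) < N := by exact_mod_cast (show 0 < N by omega)
  have hgap : 0 < 1 / 2 - b := by linarith
  have hP := oneLinkPoincareSUN_bakryEmery hN hb
  have hV := oneLinkVarianceBound_bakryEmery hN hb
  have hc : (0 : ℝ) ≤ 1 / ((N : ℝ) * (1 / 2 - b)) := by positivity
  have hv : (0 : ℝ) ≤ (N : ℝ) / (1 / 2 - b) := by positivity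
  refine dlrS_abs_sub_integral_ge_le_explicit hd (by omega) hc hv le_rfl (fun B hB => hP B hB) (fun B hB => hV B hB)
    hB₀ hmem.continuous hmem.dependsOn h1 h3 h4 h2 h5 h6 ht h7 h8 ?_ hμ hF hr
  have hsq1 : Real.sqrt (1 / ((N : ℝ) * (1 / 2 - b)) * ((N : ℝ) / (1 / 2 - b))) = 1 / (1 / 2 - b) := by
    rw [show 1 / ((N : ℝ) * (1 / 2 - b)) * ((N : ℝ) / (1 / 2 - b)) = (1 / (1 / 2 - b)) ^ 2 by field_simp,
      Real.sqrt_sq (by positivity)]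
  have hsq2 : Real.sqrt (1 / ((N : ℝ) * (1 / 2 - b))) = 1 / Real.sqrt ((N : ℝ) * (1 / 2 - b)) := by
    rw [Real.sqrt_div' _ (mul_nonneg hNpos.le hgap.le), Real.sqrt_one]
  rw [hsq1, hsq2]
  calc 6 * ((d : ℝ) - 1) * |β| * (exp a * exp t * (1 / (1 / 2 - b))) + exp (a / 2) * (1 / Real.sqrt ((N : ℝ) * (1 / 2 - b))) * Λt
      = 6 * ((d : ℝ) - 1) * |β| * (exp a * exp t) / (1 / 2 - b) + exp (a / 2) * Λt / Real.sqrt ((N : ℝ) * (1 / 2 - b)) := by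
        ring
    _ < 1 := hρ

end SUN

/-! ### `SU(2)` with the sharp one-link pair -/

section SU2

variable {d : ℕ} {W : Potential (ZdEdge d) (Matrix.specialUnitaryGroup (Fin 2) ℂ)}

variable (W) in
/-- ★★ **TIER 2, `SU(2)`, ON THE BALL `MemBallZdS a Λ_t t W`** (`t > 0`): under `2(d−1)|β_W| e^{a} e^{t} + e^{a/2} √(2/3) Λ_t < 1` (the hypothesis
of `su2_perturbedMassGapS`), for EVERY DLR state `μ` of the member ('t Hooft coupling `β_W/4`), every Lipschitz cylinder `F` (constant `K`,
links `Δ`) and every `r ≥ 0`: `μ{|F − ∫F dμ| ≥ r} ≤ 2 exp(−2 r² / (8 K² d #Δ² Θ₂(t)))`, `Θ₂(t) = ((1 + e^{−2t/d})/(1 − e^{−2t/d}))^d`.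
[folklore] -/
theorem su2_dlrS_abs_sub_integral_ge_le (hd : 1 ≤ d) {βW a Λt t : ℝ} (hmem : MemBallZdS a Λt t W) (ht : 0 < t)
    (hρ : 2 * ((d : ℝ) - 1) * |βW| * (exp a * exp t) + exp (a / 2) * Real.sqrt (2 / 3) * Λt < 1)
    {μ : Measure (LGConfig d (Matrix.specialUnitaryGroup (Fin 2) ℂ))}
    (hμ : μ ∈ perturbedGibbsMeasuresS (d := d) (fundamentalRep (Fin 2)) ((2 : ℕ) * (βW / 4)) W)
    {F : LGConfig d (Matrix.specialUnitaryGroup (Fin 2) ℂ) → ℝ} {Δ : Finset (ZdEdge d)} {K : ℝ≥0}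
    (hF : IsLipschitzCylinder (fundamentalRep (Fin 2)) F Δ K) {r : ℝ} (hr : 0 ≤ r) :
    μ.real {U | r ≤ |F U - ∫ U', F U' ∂μ|} ≤
      2 * exp (-2 * r ^ 2 / (8 * (K : ℝ) ^ 2 * d * (Δ.card : ℝ) ^ 2 *
        ((1 + exp (-(2 * t / d))) / (1 - exp (-(2 * t / d)))) ^ d)) := by
  obtain ⟨B, hB⟩ := hmem.summable
  obtain ⟨osc, lip, ℓ, h1, h2, h3, h4, h5, h6, h7, h8⟩ := hmem.loads
  have hc : (0 : ℝ) ≤ 2 / 3 := by norm_num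
  have hP : ∀ B : Matrix (Fin 2) (Fin 2) ℂ, matrixOpNorm B ≤ |βW / 4| * (2 * ((d : ℝ) - 1)) →
      ∀ (ψ : Matrix.specialUnitaryGroup (Fin 2) ℂ → ℝ) (M : ℝ), 0 ≤ M →
        (∀ x y, |ψ x - ψ y| ≤ M * suFrobDist x y) →
        Var[ψ; (haarProbability (Matrix.specialUnitaryGroup (Fin 2) ℂ)).tilted
          fun g => ((2 : ℕ) : ℝ) * ((g : Matrix (Fin 2) (Fin 2) ℂ) * B).trace.re] ≤ 2 / 3 * M ^ 2 :=
    fun B hB ψ M hM hψ => oneLinkPoincareSUN_two_sharp _ B hB ψ M hM hψ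
  have hVB := linVariance_of_poincare (N := 2) hP
  have hv : (0 : ℝ) ≤ 2 / 3 * ((2 : ℕ) : ℝ) ^ 2 := by norm_num
  have hsq : Real.sqrt (2 / 3 * (2 / 3 * ((2 : ℕ) : ℝ) ^ 2)) = 4 / 3 := by
    rw [show (2 / 3 * (2 / 3 * ((2 : ℕ) : ℝ) ^ 2) : ℝ) = (4 / 3) ^ 2 by norm_num, Real.sqrt_sq (by norm_num)]
  have hρ' : 6 * ((d : ℝ) - 1) * |βW / 4| * (exp a * exp t * Real.sqrt (2 / 3 * (2 / 3 * ((2 : ℕ) : ℝ) ^ 2))) +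
      exp (a / 2) * Real.sqrt (2 / 3) * Λt < 1 := by
    rw [hsq]
    have e : 6 * ((d : ℝ) - 1) * |βW / 4| * (exp a * exp t * (4 / 3)) = 2 * ((d : ℝ) - 1) * |βW| * (exp a * exp t) := by
      rw [abs_div, abs_of_pos (by norm_num : (0 : ℝ) < 4)]
      ring
    rw [e]
    exact hρ
  have hmain := dlrS_abs_sub_integral_ge_le_explicit (N := 2) (β := βW / 4) hd (by norm_num) hc hv le_rfl hP hVB hB
    hmem.continuous hmem.dependsOn h1 h3 h4 h2 h5 h6 ht h7 h8 hρ' hμ hF hr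
  have e2 : (4 : ℝ) * ((2 : ℕ) : ℝ) = 8 := by norm_num
  rw [e2] at hmain
  exact hmain

end SU2

end Summit.Ventures.YMGap.RobustBall

end
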